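import Literature.AlgebraicGeometry.Resolution.HypersurfaceTransform
import Literature.AlgebraicGeometry.Resolution.MaximalContactPersistence
import HarnessLib

/-!
# Hypersurfaces of maximal contact stay regular along multiple blow-ups (BGMW 2011, Lemma 3.6.4 (2)–(5) and Lemma 3.6.6 combined)

Topic: `Literature/AlgebraicGeometry/Resolution`. Bierstone–Grigoriev–Milman–Włodarczyk, *Effective
Hironaka resolution and its complexity (with appendix on applications in positive
characteristic)*, arXiv:1206.3090, §3.6 (p. 8): Lemma 3.6.4 ("(1) `V(u)` is smooth; (2)
`supp(𝓘, μ) ∩ U ⊂ V(u)` … (3) `u' ∈ 𝒟^{μ-1}(σᶜ(𝓘|U', μ))`; (4) `V(u')` is smooth; (5)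
`supp(𝓘', μ) ∩ U' ⊂ V(u')`") and Lemma 3.6.6 (Giraud: "for any multiple blow-up `(U_i)` of
`(𝓘|U, μ)`, all the supports of the induced marked ideals `supp(𝓘_i, μ)` are contained in the
strict transforms `V(u)_i` of `V(u)`").

This file ITERATES the one-step results of the tree along a multiple blow-up
(`IsMultipleBlowup`, BGMW Def. 3.1.3): `MaximalContactPersistence.lean` ((2), (3), (5) and the
weak form of 3.6.6: ideals `H_i` with `σ^*H ⊆ H_i ⊆ T(𝓘_i)`) and `HypersurfaceTransform.lean`
((4): the controlled transform of a regular hypersurface through the centre is a regular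
hypersurface). Result (`IsMultipleBlowup.exists_regular_hypersurface`): over a field `k`, for `X`
regular, locally Noetherian and locally of finite type over `Spec k`, a marked ideal
`M = (𝓘, E, μ)` with `μ ≥ 1`, an ideal sheaf `H ⊆ T(𝓘) = 𝒟^{μ-1}(𝓘)` which is a REGULAR
HYPERSURFACE in the sense that at every point of `V(H)` it is generated by an element of order
one, and a multiple blow-up `σ : X' → X` of `M` with final marked ideal `M' = (𝓘', E', μ)`: the
iterated controlled transform `H'` of `H` satisfies `σ^*H ⊆ H' ⊆ T(𝓘')`, is again a regular
hypersurface in this sense (all the `Xᵢ` being regular, Liu Thm. 8.1.19 (a)), and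
`supp(M') ⊆ V(H')`. The inclusion `Hᵢ ⊆ Cᵢ` needed at each step (the centre lies on the
hypersurface) is BGMW Lemma 3.2.1 (1) with `μ = 1` (`le_pow_of_support_subset`:
`V(Cᵢ) ⊆ supp(Mᵢ) ⊆ V(Hᵢ)` and `Cᵢ` is rsop-generated, having snc with `Eᵢ`).

As in `MaximalContactPersistence.lean`, the strict-transform identification (6) is not used:
`V(H')` replaces the strict transform `V(u)_i` (it contains `supp` and lies over `V(H)`).

## Sources

* [BGMW 2011] §3.6 Lemma 3.6.4, Lemma 3.6.6; §3.2 Lemma 3.2.1 (arXiv:1206.3090, pp. 7–8).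
  [BierstoneGrigorievMilmanWlodarczyk2011]
* Q. Liu, *Algebraic Geometry and Arithmetic Curves* (2002), Thm. 8.1.19 (a) — through
  `RegularBlowup.lean`. [Liu2002]
-/

noncomputable section

open CategoryTheory CategoryTheory.Limits AlgebraicGeometry TopologicalSpace IsLocalRing

namespace Literature.AlgebraicGeometry.Resolution

universe u

section

variable {X : Scheme.{u}}

/-- **The centre lies on the hypersurface** (BGMW Lemma 3.2.1 (1) with `μ = 1`): if `C` is
rsop-generated at its points (e.g. has simple normal crossings with a boundary) and
`V(C) ⊆ V(H)`, then `H ⊆ C`. [cite: BierstoneGrigorievMilmanWlodarczyk2011, Lemma 3.2.1 (1)] -/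
theorem le_of_support_subset_support {H C : X.IdealSheafData}
    (hC : ∀ x ∈ C.support, IsRsopGeneratedAt C x)
    (hsupp : (C.support : Set X) ⊆ H.support) : H ≤ C := by
  have h := le_pow_of_support_subset (I := H) (μ := 1) hC fun y hy => by
    rw [Nat.cast_one, one_le_idealOrder_iff]
    exact hsupp hy
  rwa [pow_one] at h

end

section Multiple

variable (k : Type u) [Field k] {X X' : Scheme.{u}} [X.Over (Spec (.of k))]
  [LocallyOfFiniteType (X ↘ Spec (.of k))] [IsLocallyNoetherian X]

/-- **Hypersurfaces of maximal contact stay regular hypersurfaces along a multiple blow-up**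
(BGMW Lemma 3.6.4 (2)–(5) iterated, with Lemma 3.6.6 in the weak form): over a field `k`, let
`X` be regular, locally Noetherian and locally of finite type over `Spec k`, `M = (𝓘, E, μ)` a
marked ideal with `μ ≥ 1`, and `H ⊆ T(𝓘) = 𝒟^{μ-1}(𝓘)` an ideal sheaf generated at every point of
`V(H)` by an element of order one (the ideal of a regular hypersurface of maximal contact). Then
along every multiple blow-up `σ : X' → X` of `M` with final marked ideal `M'` `X'` is regular and
there is an ideal sheaf `H'` on `X'` (the iterated controlled transform of `H`) with
`σ^*H ⊆ H' ⊆ T(𝓘')`, generated at every point of `V(H')` by an element of order one, and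
`supp(M') ⊆ V(H')`.
[cite: BierstoneGrigorievMilmanWlodarczyk2011, Lemma 3.6.4 and Lemma 3.6.6] -/
theorem IsMultipleBlowup.exists_regular_hypersurface (hX : Scheme.IsRegular X) {M : MarkedIdeal X}
    {σ : X' ⟶ X} {M' : MarkedIdeal X'} (h : IsMultipleBlowup M σ M') (hμ : 1 ≤ M.mult)
    {H : X.IdealSheafData} (hH : H ≤ derivIdealSheafIter (overHom k X) (M.mult - 1) M.ideal)
    (hreg : ∀ x ∈ H.support, ∃ v : X.presheaf.stalk x,
      stalkIdeal H x = Ideal.span {v} ∧ v ∉ (maximalIdeal (X.presheaf.stalk x)) ^ 2) :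
    Scheme.IsRegular X' ∧ ∃ H' : X'.IdealSheafData, H.comap σ ≤ H' ∧ M'.mult = M.mult ∧
      H' ≤ derivIdealSheafIter (σ.appTop.hom.comp (overHom k X)) (M'.mult - 1) M'.ideal ∧
      (∀ x' ∈ H'.support, ∃ v : X'.presheaf.stalk x',
        stalkIdeal H' x' = Ideal.span {v} ∧ v ∉ (maximalIdeal (X'.presheaf.stalk x')) ^ 2) ∧
      M'.support ⊆ (H'.support : Set X') := by
  induction h with
  | refl =>
    refine ⟨hX, H, by rw [Scheme.IdealSheafData.comap_id], rfl, by rwa [id_appTop_comp], hreg, ?_⟩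
    exact M.support_subset_support_of_le_deriv (hasFinitePresentationDifferentials_overHom k X)
      hμ hH
  | @blowup X' X'' σ M' h C τ hτ hC hsupp hsnc ih =>
    obtain ⟨hX', H₁, hHH₁, hmult, hH₁, hreg₁, hsupp₁⟩ := ih
    haveI := h.isLocallyNoetherian
    haveI : IsProper σ := h.isProper
    haveI : IsProper τ := hτ.isProper
    haveI : IsLocallyNoetherian X'' := LocallyOfFiniteType.isLocallyNoetherian τ
    have hfX' := hasFinitePresentationDifferentials_appTop_comp_overHom k σ
    have hfX'' : HasFinitePresentationDifferentials
        (τ.appTop.hom.comp (σ.appTop.hom.comp (overHom k X))) := by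
      rw [← comp_appTop_comp]
      exact hasFinitePresentationDifferentials_appTop_comp_overHom k (τ ≫ σ)
    -- the centre lies on the hypersurface: `H₁ ⊆ C`
    have hH₁C : H₁ ≤ C :=
      le_of_support_subset_support (fun x hx => hsnc.isRsopGeneratedAt hx) (hsupp.trans hsupp₁)
    refine ⟨hτ.isRegular_of_isRegular_subscheme hX' hC, controlledTransform τ C H₁ 1, ?_,
      by simpa using hmult, ?_, ?_, ?_⟩
    · rw [Scheme.IdealSheafData.comap_comp]
      exact (Scheme.IdealSheafData.comap_mono (f := τ) hHH₁).trans
        (comap_le_controlledTransform τ C H₁ 1)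
    · rw [comp_appTop_comp]
      exact hτ.transform_hypersurface_le hfX' hfX'' M' (by omega) hsupp hsnc hH₁
    · exact hτ.exists_generator_notMem_sq_controlledTransform hX' hC hH₁C hreg₁
    · exact hτ.support_transform_subset hfX' hfX'' M' (by omega) hsupp hsnc hH₁

end Multiple

end Literature.AlgebraicGeometry.Resolution

end
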